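import Summits.Ventures.WeilGRH.UniformConductorFloorLog9Decision
import Summits.Ventures.WeilGRH.UniformConductorFloorPrincipalMod69Log9
import Summits.Ventures.WeilGRH.UniformConductorFloorPrincipalMod127Log9
import Summits.Ventures.WeilGRH.UniformConductorFloorPrincipalMod131Log9
import HarnessLib

/-!
# GRH arm (rh-explicit, venture WeilGRH): the COMPLETE all-moduli decision at the window `log 3`, and the prime threshold `127`

Cell `rh-explicit`, WEIL TRACK — GRH ARM (weil-grh-1, gen9).  Assembly of `UniformConductorFloorLog9Decision.lean` (decision modulo `69, 127, 131`) with the three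
principal cells `UniformConductorFloorPrincipalMod69Log9.lean` / `…Mod127Log9.lean` / `…Mod131Log9.lean` (door E on the `log 3` special-value table `Log9Table`;
kernel margins `0.022 ∣ 1.66`, `0.0024 ∣ 1.80`, `0.031 ∣ 1.83`) and gen8's domination theorem.

**THEOREM (`forall_weilPositivityOnChar_log_three_iff_not_mem_complete`).**  For EVERY modulus `q ≥ 2`: every Dirichlet character mod `q` is Weil-positive on
`[−log 3, log 3]` iff `q ∉ F₉⁺ = F₉ ∪ {45, 85}` (66 moduli: `2,…,29`, `31,…,35`, `37, 38, 39, 41, 43, 44, 45, 46, 47, 49, 51, 53, 55, 57, 59, 61, 65, 67, 71, 73, 77,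
79, 83, 85, 89, 91, 97, 101, 103, 107, 109, 113, 121`); on `F₉⁺` the failing character is the principal one (flat window on 64, 28-mode Galerkin vectors at `45`, `85`).
**THEOREM (`forall_weilPositivityOnChar_log_three_iff_of_prime_complete`).**  For a PRIME `p`: every Dirichlet character mod `p` is Weil-positive on `[−log 3, log 3]`
iff `p ≥ 127` — EXACT, as the earlier rungs: `t = 1` ↔ `p ≥ 79` (gen8), `(log 8)/2` ↔ `p ≥ 97` (gen9), `log 3` ↔ `p ≥ 127` (gen9); in each case the largest failing
prime (`73`, `89`, `113`) fails by the FLAT window and the first passing prime is certified by a uniform joint-cell floor (`78`, `97`) or, here, by a direct principal cell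
(`127`, margin `0.0024`; true threshold of the coprime form ≈ `125.05`).  RH/GRH-free; standard axioms.

## References

* A. Weil (1952), (11) pp. 261–262 and the «lemme» p. 262 [Weil1952FormulesExplicites]; H. Yoshida (1992) §§5–7 [Yoshida1992HermitianForms].
-/

noncomputable section

namespace Summit.Ventures.WeilGRH

open Literature.NumberTheory.LFunctions

namespace UniformFloor

variable {q : ℕ}

/-- `0 < log 3`. [folklore] -/
private theorem log_three_pos : (0 : ℝ) < Real.log 3 := Real.log_pos (by norm_num)

/-- ★★ `U_{log 3}(69)`: every Dirichlet character mod `69` is Weil-positive on `[−log 3, log 3]`. [cite: Weil1952FormulesExplicites, (11) pp. 261–262] -/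
theorem forall_weilPositivityOnChar_log_three_mod_sixtyNine (χ : DirichletCharacter ℂ 69) : WeilPositivityOnChar χ (Real.log 3) :=
  WeilPositivityOnChar.of_principal (by norm_num) log_three_pos PrincipalMod69Log9.weilPositivityOnChar_log_three_principal_mod_sixtyNine χ

/-- ★★ `U_{log 3}(127)`: every Dirichlet character mod `127` is Weil-positive on `[−log 3, log 3]`. [cite: Weil1952FormulesExplicites, (11) pp. 261–262] -/
theorem forall_weilPositivityOnChar_log_three_mod_oneTwentySeven (χ : DirichletCharacter ℂ 127) : WeilPositivityOnChar χ (Real.log 3) :=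
  WeilPositivityOnChar.of_principal (by norm_num) log_three_pos PrincipalMod127Log9.weilPositivityOnChar_log_three_principal_mod_oneTwentySeven χ

/-- ★★ `U_{log 3}(131)`: every Dirichlet character mod `131` is Weil-positive on `[−log 3, log 3]`. [cite: Weil1952FormulesExplicites, (11) pp. 261–262] -/
theorem forall_weilPositivityOnChar_log_three_mod_oneThirtyOne (χ : DirichletCharacter ℂ 131) : WeilPositivityOnChar χ (Real.log 3) :=
  WeilPositivityOnChar.of_principal (by norm_num) log_three_pos PrincipalMod131Log9.weilPositivityOnChar_log_three_principal_mod_oneThirtyOne χ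

/-- ★★★ **ALL MODULI at `log 3` — COMPLETE.**  For every `q ≥ 2`: every Dirichlet character mod `q` is Weil-positive on `[−log 3, log 3]` iff `q ∉ F₉⁺` (66 moduli).
[cite: Weil1952FormulesExplicites, (11) pp. 261–262 and the «lemme» p. 262] -/
theorem forall_weilPositivityOnChar_log_three_iff_not_mem_complete (hq2 : 2 ≤ q) :
    (∀ χ : DirichletCharacter ℂ q, WeilPositivityOnChar χ (Real.log 3)) ↔ q ∉ ({2, 3, 4, 5, 6, 7, 8, 9, 10, 11, 12, 13, 14, 15, 16, 17, 18, 19, 20, 21, 22, 23, 24, 25, 26, 27, 28, 29, 31, 32,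
      33, 34, 35, 37, 38, 39, 41, 43, 44, 45, 46, 47, 49, 51, 53, 55, 57, 59, 61, 65, 67, 71, 73, 77, 79, 83, 85, 89,
      91, 97, 101, 103, 107, 109, 113, 121} : Finset ℕ) := by
  by_cases h69 : q = 69
  · subst h69; exact ⟨fun _ h ↦ by simp at h, fun _ χ ↦ forall_weilPositivityOnChar_log_three_mod_sixtyNine χ⟩
  by_cases h127 : q = 127
  · subst h127; exact ⟨fun _ h ↦ by simp at h, fun _ χ ↦ forall_weilPositivityOnChar_log_three_mod_oneTwentySeven χ⟩
  by_cases h131 : q = 131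
  · subst h131; exact ⟨fun _ h ↦ by simp at h, fun _ χ ↦ forall_weilPositivityOnChar_log_three_mod_oneThirtyOne χ⟩
  have hE : q ∉ ({69, 127, 131} : Finset ℕ) := by
    simp only [Finset.mem_insert, Finset.mem_singleton]
    omega
  exact forall_weilPositivityOnChar_log_three_iff_not_mem hq2 hE

/-- **Equivalently**: for every `q ≥ 2`, some character mod `q` fails on `[−log 3, log 3]` iff `q ∈ F₉⁺`, and then the principal one does.
[cite: Weil1952FormulesExplicites, (11) pp. 261–262] -/
theorem exists_not_weilPositivityOnChar_log_three_iff_mem_complete (hq2 : 2 ≤ q) :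
    (∃ χ : DirichletCharacter ℂ q, ¬ WeilPositivityOnChar χ (Real.log 3)) ↔ q ∈ ({2, 3, 4, 5, 6, 7, 8, 9, 10, 11, 12, 13, 14, 15, 16, 17, 18, 19, 20, 21, 22, 23, 24, 25, 26, 27, 28, 29, 31, 32,
      33, 34, 35, 37, 38, 39, 41, 43, 44, 45, 46, 47, 49, 51, 53, 55, 57, 59, 61, 65, 67, 71, 73, 77, 79, 83, 85, 89,
      91, 97, 101, 103, 107, 109, 113, 121} : Finset ℕ) := by
  have h := forall_weilPositivityOnChar_log_three_iff_not_mem_complete hq2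
  constructor
  · rintro ⟨χ, hχ⟩
    by_contra hF
    exact hχ (h.2 hF χ)
  · intro hF
    exact ⟨1, not_weilPositivityOnChar_log_three_principal_of_mem hF⟩

/-- ★★★ **PRIME MODULI at `log 3`: the exact dichotomy `p ≥ 127`.**  For a prime `p`, every Dirichlet character mod `p` is Weil-positive on `[−log 3, log 3]`
iff `p ≥ 127` (the primes `≤ 113` fail by the flat window; `127`, `131` by direct principal cells; `p ≥ 137` by the uniform floor `133`).
[cite: Weil1952FormulesExplicites, (11) pp. 261–262 and the «lemme» p. 262] -/
theorem forall_weilPositivityOnChar_log_three_iff_of_prime_complete (hp : q.Prime) :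
    (∀ χ : DirichletCharacter ℂ q, WeilPositivityOnChar χ (Real.log 3)) ↔ 127 ≤ q := by
  constructor
  · intro h
    by_contra hlt
    have h113 : q ≤ 113 := by
      by_contra h'
      have h114 : 114 ≤ q := by omega
      have h126 : q ≤ 126 := by omega
      interval_cases q <;> exact absurd hp (by norm_num)
    exact not_weilPositivityOnChar_log_three_principal_of_prime_le hp h113 (h 1)
  · intro h127 χ
    by_cases h133 : 133 ≤ q
    · exact weilPositivityOnChar_log_three_of_ge_133 h133 χ
    · have hq : q = 127 ∨ q = 131 := by
        have h132 : q ≤ 132 := by omega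
        interval_cases q <;> first | exact Or.inl rfl | exact Or.inr rfl | exact absurd hp (by norm_num)
      rcases hq with rfl | rfl
      · exact forall_weilPositivityOnChar_log_three_mod_oneTwentySeven χ
      · exact forall_weilPositivityOnChar_log_three_mod_oneThirtyOne χ

/-- … and `113` is sharp (`UniformConductorFloorPrincipalLog9.exists_not_weilPositivityOnChar_log_three_oneThirteen`), while `127` passes: the THREE RUNGS of the
principal dichotomy for prime moduli read `79` (`t = 1`), `97` (`t = (log 8)/2`), `127` (`t = log 3`). [cite: Weil1952FormulesExplicites, (11) pp. 261–262] -/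
theorem forall_weilPositivityOnChar_log_three_oneTwentySeven :
    ∀ χ : DirichletCharacter ℂ 127, WeilPositivityOnChar χ (Real.log 3) :=
  forall_weilPositivityOnChar_log_three_mod_oneTwentySeven

end UniformFloor

end Summit.Ventures.WeilGRH

end
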